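import Mathlib
import Literature.NumberTheory.Transcendental.DrinfeldAssociator
import Literature.NumberTheory.Transcendental.AssociatorsHexagonProofs
import Literature.NumberTheory.Transcendental.MultipleZetaValuesProofs
import HarnessLib

/-!
# The Drinfeld associator II: reduction of the GT-relations for `(2πi, Φ_KZ)` to Drinfeld's
# pentagon, group-likeness and Furusho's "pentagon ⇒ hexagons"

Proofs file accompanying `DrinfeldAssociator.lean` (named fact
`drinfeldAssociator_isAssociatorPair` = [Furusho2011, §1]: "It is shown in [Dr] that `Φ_KZ`
satisfies GT-relations (with `μ = 2πi`)"). Everything here is proved; no named fact is introduced.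

1. `NCSeries.isUnit_evalTrunc` — a series with constant term `1` has invertible image under every
   nilpotent substitution (`φ(a,b) = 1 +` nilpotent), so that `Ring.inverse` in the hexagon
   equations is a genuine inverse and commutes with base change
   (`map_ringInverse_of_isUnit`).
2. `NCSeries.DrinfeldHexagon.map`, `NCSeries.DrinfeldHexagonB.map`, `NCSeries.IsAssociatorPair.map`
   — **the GT-relations are preserved by change of coefficients** `f : R → S` of `ℚ`-algebras
   (`(f μ, f_* φ)` is an associator pair when `(μ, φ)` is), completing `IsGroupLike.map` and
   `DrinfeldPentagon.map` of `Associators.lean`. [folklore; Drinfeld1991, §4–5 (functoriality of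
   `M̲(k)` in `k`)]
3. `drinfeldAssociator_X₀X₁_eq` — `c_{X₀X₁}(Φ_KZ) = -ζ(2) = -π²/6`, hence
   `(2πi)² = 24 c_{X₀X₁}(Φ_KZ)` (`two_pi_I_sq_eq`): the normalisation `c_{X₀X₁}(φ) = μ²/24` of
   [Furusho2011, §1] singles out `μ = ±2πi` for `Φ_KZ`.
4. `map_conj_drinfeldAssociator_complex` — `Φ_KZ` has real coefficients, so complex conjugation fixes
   `Φ_KZ ∈ ℂ⟨⟨X₀,X₁⟩⟩` and exchanges the hexagons for `μ` and `μ̄`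
   (`drinfeldHexagon_conj`, `drinfeldHexagonB_conj`).
5. **`drinfeldAssociator_isAssociatorPair_of_pentagon`** — the reduction: Drinfeld's
   group-likeness and pentagon for `Φ_KZ` (the named facts `drinfeldAssociator_isGroupLike`,
   `drinfeldAssociator_pentagon`) together with Furusho's theorem [Furusho2010, Thm 1]
   (`furusho_pentagon_hexagon`: pentagon ⇒ hexagons for some `μ` with `μ² = 24 c_{X₀X₁}`) imply
   `drinfeldAssociator_isAssociatorPair`: over `ℝ̄ → ℂ` the `μ` provided by Furusho satisfies
   `μ² = -4π²`, so `μ = ±2πi`, and the sign is immaterial by item 4.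

## References

* H. Furusho, *Double shuffle relation for associators*, Ann. of Math. 174 (2011), 341–360, §1
  (arXiv:0808.0319, p. 3). [Furusho2011]
* H. Furusho, *Pentagon and hexagon equations*, Ann. of Math. 171 (2010), 545–556, Thm 1.
  [Furusho2010]
* V. G. Drinfel'd, *On quasitriangular quasi-Hopf algebras and on a group that is closely connected
  with Gal(Q̄/Q)*, Leningrad Math. J. 2 (1991), 829–860, §2, §5. [Drinfeld1991]
-/

noncomputable section

open scoped BigOperators

namespace Literature.NumberTheory.Transcendental

universe u v

/-! ## 1. Units: `φ(a, b)` is invertible when `c_∅(φ) = 1` -/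

/-- A monoid-with-zero morphism maps the `Ring.inverse` of a unit to the `Ring.inverse` of its
image. [folklore] -/
theorem map_ringInverse_of_isUnit {A B F : Type*} [MonoidWithZero A] [MonoidWithZero B]
    [FunLike F A B] [MonoidHomClass F A B] (f : F) {x : A} (hx : IsUnit x) :
    f (Ring.inverse x) = Ring.inverse (f x) := by
  obtain ⟨u, rfl⟩ := hx
  have h1 : f (u : A) * f (↑u⁻¹ : A) = 1 := by rw [← map_mul, Units.mul_inv, map_one]
  have h2 : f (↑u⁻¹ : A) * f (u : A) = 1 := by rw [← map_mul, Units.inv_mul, map_one]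
  rw [Ring.inverse_unit]
  exact (Ring.inverse_unit ⟨_, _, h1, h2⟩).symm

namespace NCSeries

section Units

variable {α : Type u} {R : Type v} [CommRing R] {A : Type*} [Ring A] [Algebra R A] [Fintype α]
  [DecidableEq α]

/-- **`φ(v)` is a unit when `c_∅(φ) = 1`**: on an `(N+1)`-nilpotent substitution `v`,
`φ(v) = 1 + (φ - 1)(v)` with `(φ - 1)(v)^{N+1} = ((φ-1)^{N+1})(v) = 0`. In particular the
inverses `φ(t_ij, t_kl)⁻¹` in the hexagon equations are genuine inverses for group-like `φ`.
[folklore] -/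
theorem isUnit_evalTrunc (N : ℕ) (v : α → A)
    (hv : ∀ w : List α, N < w.length → (w.map v).prod = 0) {φ : NCSeries α R} (h1 : φ [] = 1) :
    IsUnit (evalTrunc N v φ) := by
  have h0 : (φ - 1) [] = 0 := by rw [sub_apply, h1, one_apply_nil, sub_self]
  have hmem : (φ - 1) ^ (N + 1) ∈ truncIdeal α R N := by
    rw [mem_truncIdeal]
    intro w hw
    have h := list_prod_apply_eq_zero (List.replicate (N + 1) (φ - 1))
      (fun S hS => by rw [List.eq_of_mem_replicate hS]; exact h0) w (by simp; omega)
    rwa [List.prod_replicate] at h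
  have hnil : IsNilpotent (evalTrunc N v (φ - 1)) :=
    ⟨N + 1, by rw [← evalTrunc_pow N v hv, evalTrunc_eq_zero_of_mem_truncIdeal N v hmem]⟩
  have hφ : evalTrunc N v φ = 1 + evalTrunc N v (φ - 1) := by
    rw [← evalTrunc_one (R := R) N v, ← evalTrunc_add, add_sub_cancel]
  rw [hφ]
  exact hnil.isUnit_one_add

end Units

/-! ## 2. The hexagon equations under change of coefficients -/

section HexagonMap

variable {R : Type u} {S : Type v} [CommRing R] [CommRing S]

/-- Substitutions of the letters by elements of the span of the generators `t_ij` are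
`(N+1)`-nilpotent. [folklore] -/
theorem prod_map_bsub_eq_zero_of_mem_genSpan {N : ℕ} {a b : DrinfeldKohnoTrunc R (Fin 4) N}
    (ha : a ∈ (DrinfeldKohnoTrunc.genSpan : Submodule R (DrinfeldKohnoTrunc R (Fin 4) N)))
    (hb : b ∈ (DrinfeldKohnoTrunc.genSpan : Submodule R (DrinfeldKohnoTrunc R (Fin 4) N)))
    (w : List Bool) (hw : N < w.length) : (w.map (bsub a b)).prod = 0 :=
  DrinfeldKohnoTrunc.prod_map_eq_zero_of_mem_genSpan (bsub a b)
    (fun c => by cases c <;> assumption) w hw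

/-- `φ(a, b)` is a unit for `a, b` in the span of the `t_ij` and `c_∅(φ) = 1`. [folklore] -/
theorem isUnit_subst₂ {N : ℕ} {φ : NCSeries Bool R} (h1 : φ [] = 1)
    {a b : DrinfeldKohnoTrunc R (Fin 4) N}
    (ha : a ∈ (DrinfeldKohnoTrunc.genSpan : Submodule R (DrinfeldKohnoTrunc R (Fin 4) N)))
    (hb : b ∈ (DrinfeldKohnoTrunc.genSpan : Submodule R (DrinfeldKohnoTrunc R (Fin 4) N))) :
    IsUnit (subst₂ N φ a b) :=
  isUnit_evalTrunc N (bsub a b) (prod_map_bsub_eq_zero_of_mem_genSpan ha hb) h1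

/-- Base change of `Ring.inverse (φ(t_ij, t_kl))` for `c_∅(φ) = 1`. [folklore] -/
theorem map_ringInverse_subst₂ (f : R →+* S) {N : ℕ} {φ : NCSeries Bool R} (h1 : φ [] = 1)
    {a b : DrinfeldKohnoTrunc R (Fin 4) N}
    (ha : a ∈ (DrinfeldKohnoTrunc.genSpan : Submodule R (DrinfeldKohnoTrunc R (Fin 4) N)))
    (hb : b ∈ (DrinfeldKohnoTrunc.genSpan : Submodule R (DrinfeldKohnoTrunc R (Fin 4) N))) :
    DrinfeldKohnoTrunc.map f (Ring.inverse (subst₂ N φ a b)) =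
      Ring.inverse (subst₂ N (map f φ) (DrinfeldKohnoTrunc.map f a) (DrinfeldKohnoTrunc.map f b)) := by
  rw [map_ringInverse_of_isUnit (DrinfeldKohnoTrunc.map f) (isUnit_subst₂ h1 ha hb)]
  exact congrArg Ring.inverse (map_subst₂ f N φ a b)

variable [Algebra ℚ R] [Algebra ℚ S]

/-- Base change of the exponential factors `exp{(μ/2) x}`. [folklore] -/
theorem map_expT_half_smul (f : R →+* S) {N : ℕ} (μ : R) (x : DrinfeldKohnoTrunc R (Fin 4) N) :
    DrinfeldKohnoTrunc.map f (DrinfeldKohnoTrunc.expT (((1 / 2 : ℚ) • μ) • x)) =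
      DrinfeldKohnoTrunc.expT (((1 / 2 : ℚ) • f μ) • DrinfeldKohnoTrunc.map f x) := by
  rw [DrinfeldKohnoTrunc.map_expT, DrinfeldKohnoTrunc.map_smul, map_rat_smul]

/-- **The first hexagon equation is preserved by change of coefficients** of `ℚ`-algebras, for
series with constant term `1`. [folklore] -/
theorem DrinfeldHexagon.map {μ : R} {φ : NCSeries Bool R} (h : DrinfeldHexagon μ φ)
    (h1 : φ [] = 1) (f : R →+* S) : DrinfeldHexagon (f μ) (map f φ) := by
  intro N
  have h' := congrArg (DrinfeldKohnoTrunc.map f) (h N)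
  rw [map_mul, map_mul, map_mul, map_mul, map_expT_half_smul, map_expT_half_smul,
    map_expT_half_smul,
    map_ringInverse_subst₂ f h1 (DrinfeldKohnoTrunc.t_mem_genSpan (N := N) 0 2)
      (DrinfeldKohnoTrunc.t_mem_genSpan (N := N) 1 2),
    map_subst₂, map_subst₂, map_add] at h'
  simpa only [t₄, DrinfeldKohnoTrunc.map_t] using h'

/-- **The second hexagon equation is preserved by change of coefficients** of `ℚ`-algebras, for
series with constant term `1`. [folklore] -/
theorem DrinfeldHexagonB.map {μ : R} {φ : NCSeries Bool R} (h : DrinfeldHexagonB μ φ)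
    (h1 : φ [] = 1) (f : R →+* S) : DrinfeldHexagonB (f μ) (map f φ) := by
  intro N
  have h' := congrArg (DrinfeldKohnoTrunc.map f) (h N)
  rw [map_mul, map_mul, map_mul, map_mul, map_expT_half_smul, map_expT_half_smul,
    map_expT_half_smul,
    map_ringInverse_subst₂ f h1 (DrinfeldKohnoTrunc.t_mem_genSpan (N := N) 1 2)
      (DrinfeldKohnoTrunc.t_mem_genSpan (N := N) 0 2),
    map_ringInverse_subst₂ f h1 (DrinfeldKohnoTrunc.t_mem_genSpan (N := N) 0 1)
      (DrinfeldKohnoTrunc.t_mem_genSpan (N := N) 1 2), map_subst₂, map_add] at h'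
  simpa only [t₄, DrinfeldKohnoTrunc.map_t] using h'

/-- **The GT-relations are preserved by change of coefficients** of `ℚ`-algebras: if `(μ, φ)` is
an associator pair over `R` then `(f μ, f_* φ)` is one over `S` (the map `M̲(R) → M̲(S)`).
[folklore] -/
theorem IsAssociatorPair.map {μ : R} {φ : NCSeries Bool R} (h : IsAssociatorPair μ φ)
    (f : R →+* S) : IsAssociatorPair (f μ) (map f φ) :=
  ⟨h.1.map f, h.2.1.map f, h.2.2.1.map h.1.apply_nil f, h.2.2.2.map h.1.apply_nil f⟩

end HexagonMap

end NCSeries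

/-! ## 3. The normalisation `c_{X₀X₁}(Φ_KZ) = -π²/6 = (2πi)²/24` -/

open NCSeries

/-- **`c_{X₀X₁}(Φ_KZ) = -ζ(2) = -π²/6`.** [cite: Furusho2003, after Prop. 3.2.3 (Φ_KZ = 1 - ζ(2)[A,B] + ⋯)] -/
theorem drinfeldAssociator_X₀X₁_eq : drinfeldAssociator [false, true] = -(Real.pi ^ 2 / 6) := by
  rw [drinfeldAssociator_X₀X₁, multipleZeta_two]

/-- **`(2πi)² = 24 c_{X₀X₁}(Φ_KZ)`**: `Φ_KZ` has the normalisation `c_{X₀X₁} = μ²/24` of an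
associator with `μ = ±2πi` ([Furusho2011, §1]: the hexagons for `(μ, φ)` imply
`c_{X₀X₁}(φ) = μ²/24`). [cite: Furusho2011, §1] -/
theorem two_pi_I_sq_eq :
    (2 * Real.pi * Complex.I : ℂ) ^ 2 = 24 * algebraMap ℝ ℂ (drinfeldAssociator [false, true]) := by
  rw [drinfeldAssociator_X₀X₁_eq, Complex.coe_algebraMap]
  push_cast
  ring_nf
  rw [Complex.I_sq]
  ring

/-- The solutions of `z² = 24 c_{X₀X₁}(Φ_KZ)` in `ℂ` are `z = ±2πi`. [folklore] -/
theorem eq_or_eq_neg_of_sq_eq {z : ℂ}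
    (hz : z ^ 2 = 24 * algebraMap ℝ ℂ (drinfeldAssociator [false, true])) :
    z = 2 * Real.pi * Complex.I ∨ z = -(2 * Real.pi * Complex.I) := by
  rw [← two_pi_I_sq_eq] at hz
  exact sq_eq_sq_iff_eq_or_eq_neg.mp hz

/-! ## 4. Complex conjugation fixes `Φ_KZ` -/

/-- **Complex conjugation fixes `Φ_KZ`** (its coefficients are real). [folklore] -/
theorem map_conj_drinfeldAssociator_complex :
    NCSeries.map (starRingEnd ℂ) (NCSeries.map (algebraMap ℝ ℂ) drinfeldAssociator) = (NCSeries.map (algebraMap ℝ ℂ) drinfeldAssociator) := by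
  ext w
  simp [Complex.conj_ofReal]

/-- More generally every `ℝ`-algebra endomorphism of `ℂ`... concretely: any ring map `g` out of an
`ℝ`-algebra `K` into `ℂ` compatible with the structure maps sends the base change of `Φ_KZ` to `K`
back to `Φ_KZ ∈ ℂ⟨⟨X₀,X₁⟩⟩`. [folklore] -/
theorem map_algHom_drinfeldAssociator {K : Type*} [CommRing K] [Algebra ℝ K] (g : K →ₐ[ℝ] ℂ) :
    NCSeries.map (g : K →+* ℂ) (NCSeries.map (algebraMap ℝ K) drinfeldAssociator) =
      (NCSeries.map (algebraMap ℝ ℂ) drinfeldAssociator) := by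
  ext w
  simp [AlgHom.commutes]

/-- The first hexagon for `(μ, Φ_KZ)` implies the first hexagon for `(μ̄, Φ_KZ)`. [folklore] -/
theorem drinfeldHexagon_conj {μ : ℂ} (h : DrinfeldHexagon μ (NCSeries.map (algebraMap ℝ ℂ) drinfeldAssociator)) :
    DrinfeldHexagon (starRingEnd ℂ μ) (NCSeries.map (algebraMap ℝ ℂ) drinfeldAssociator) := by
  have h1 : (NCSeries.map (algebraMap ℝ ℂ) drinfeldAssociator) [] = 1 := by simp [drinfeldAssociator_nil]
  simpa only [map_conj_drinfeldAssociator_complex] using h.map h1 (starRingEnd ℂ)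

/-- The second hexagon for `(μ, Φ_KZ)` implies the second hexagon for `(μ̄, Φ_KZ)`. [folklore] -/
theorem drinfeldHexagonB_conj {μ : ℂ} (h : DrinfeldHexagonB μ (NCSeries.map (algebraMap ℝ ℂ) drinfeldAssociator)) :
    DrinfeldHexagonB (starRingEnd ℂ μ) (NCSeries.map (algebraMap ℝ ℂ) drinfeldAssociator) := by
  have h1 : (NCSeries.map (algebraMap ℝ ℂ) drinfeldAssociator) [] = 1 := by simp [drinfeldAssociator_nil]
  simpa only [map_conj_drinfeldAssociator_complex] using h.map h1 (starRingEnd ℂ)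

/-- `conj (-2πi) = 2πi`. [folklore] -/
theorem conj_neg_two_pi_I :
    starRingEnd ℂ (-(2 * Real.pi * Complex.I)) = 2 * Real.pi * Complex.I := by
  apply Complex.ext <;> simp

/-! ## 5. The reduction to Drinfeld's pentagon, group-likeness and Furusho's theorem -/

/-- **Hexagons for `(2πi, Φ_KZ)` from hexagons for any admissible `μ`**: if `(μ, Φ_KZ)` satisfies
both hexagon equations for some `μ ∈ ℂ` with `μ² = 24 c_{X₀X₁}(Φ_KZ)` (i.e. `μ = ±2πi`), then so
does `(2πi, Φ_KZ)` (complex conjugation fixes `Φ_KZ` and exchanges `±2πi`). [folklore] -/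
theorem drinfeldHexagons_two_pi_I_of_sq_eq {μ : ℂ}
    (hμ : μ ^ 2 = 24 * algebraMap ℝ ℂ (drinfeldAssociator [false, true]))
    (hH : DrinfeldHexagon μ (NCSeries.map (algebraMap ℝ ℂ) drinfeldAssociator)) (hHB : DrinfeldHexagonB μ (NCSeries.map (algebraMap ℝ ℂ) drinfeldAssociator)) :
    DrinfeldHexagon (2 * Real.pi * Complex.I : ℂ) (NCSeries.map (algebraMap ℝ ℂ) drinfeldAssociator) ∧
      DrinfeldHexagonB (2 * Real.pi * Complex.I : ℂ) (NCSeries.map (algebraMap ℝ ℂ) drinfeldAssociator) := by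
  rcases eq_or_eq_neg_of_sq_eq hμ with rfl | rfl
  · exact ⟨hH, hHB⟩
  · exact ⟨conj_neg_two_pi_I ▸ drinfeldHexagon_conj hH, conj_neg_two_pi_I ▸ drinfeldHexagonB_conj hHB⟩

/-- **Reduction of Drinfeld's theorem "`(2πi, Φ_KZ)` satisfies the GT-relations" to its pentagon
and group-likeness parts plus Furusho's "pentagon ⇒ hexagons"** [Furusho2010, Thm 1]
(`furusho_pentagon_hexagon`, applied over `k = ℝ`): Furusho provides `μ ∈ ℝ̄` with
`μ² = 24 c_{X₀X₁}(Φ_KZ) = -4π²` and both hexagons over `ℝ̄`; pushing forward along an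
`ℝ`-embedding `ℝ̄ → ℂ` (`IsAlgClosed.lift`) gives the hexagons over `ℂ` for `μ = ±2πi`, and the
sign is removed by complex conjugation. [cite: Furusho2011, §1; Furusho2010, Thm 1] -/
theorem drinfeldAssociator_isAssociatorPair_of_pentagon (hg : drinfeldAssociator_isGroupLike)
    (hp : drinfeldAssociator_pentagon) (hf : furusho_pentagon_hexagon) :
    drinfeldAssociator_isAssociatorPair := by
  obtain ⟨μ, hμ, hH, hHB⟩ := hf ℝ drinfeldAssociator hg hp
  let g : AlgebraicClosure ℝ →ₐ[ℝ] ℂ := IsAlgClosed.lift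
  have h1 : (NCSeries.map (algebraMap ℝ (AlgebraicClosure ℝ)) drinfeldAssociator) [] = 1 := by
    simp [drinfeldAssociator_nil]
  have hH' : DrinfeldHexagon ((g : AlgebraicClosure ℝ →+* ℂ) μ) (NCSeries.map (algebraMap ℝ ℂ) drinfeldAssociator) := by
    simpa only [map_algHom_drinfeldAssociator] using hH.map h1 (g : AlgebraicClosure ℝ →+* ℂ)
  have hHB' : DrinfeldHexagonB ((g : AlgebraicClosure ℝ →+* ℂ) μ) (NCSeries.map (algebraMap ℝ ℂ) drinfeldAssociator) := by
    simpa only [map_algHom_drinfeldAssociator] using hHB.map h1 (g : AlgebraicClosure ℝ →+* ℂ)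
  have h24 : (24 : AlgebraicClosure ℝ) = algebraMap ℝ (AlgebraicClosure ℝ) 24 := by
    rw [map_ofNat]
  have hμ' : ((g : AlgebraicClosure ℝ →+* ℂ) μ) ^ 2 =
      24 * algebraMap ℝ ℂ (drinfeldAssociator [false, true]) := by
    have h := congrArg g hμ
    rw [map_pow, h24, ← map_mul, AlgHom.commutes, map_mul, map_ofNat] at h
    exact h
  obtain ⟨hHex, hHexB⟩ := drinfeldHexagons_two_pi_I_of_sq_eq hμ' hH' hHB'
  exact ⟨hg.map _, hp.map _, hHex, hHexB⟩

end Literature.NumberTheory.Transcendental
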